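import Mathlib
import HarnessLib
import Summits.QuantumFields.YangMills.Theses.PencilRigidity
import Literature.MathematicalPhysics.QuantumFieldTheory.OSReconstructionNoE1Proofs
import Summits.QuantumFields.YangMills.Theorems.PencilRigidityCurvatureKernelBoundKernelPinning
import Summits.QuantumFields.YangMills.Theorems.PencilRigidityCurvatureKernelBoundHalfSpaceKernelBumps
import Summits.QuantumFields.YangMills.Theorems.PencilRigidityCurvatureKernelBoundHalfSpaceKernelCluster
import Summits.QuantumFields.YangMills.Theorems.PencilRigidityCurvatureKernelBoundHalfSpaceKernelRiemann

/-!
# `CurvatureKernelBound` — stub H `HalfSpaceKernel`: Riemann sums of weakly convergent equicontinuous matrix elements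

(support for stmt-QuantumFields-11687, line `sixteen-charts-analytic-kernel`, skeleton v11)

`tendsto_riemannSum_inner`: along the ultrafilter, the Riemann sums of `u(c) ⟪Φc c, wₙ⟫` tend to `∫ u ⟪Φc, Ψ⟫`.
Headline (registered sub-goal): `CubeExactnessRegion`.
-/

noncomputable section

open scoped BigOperators Topology SchwartzMap ComplexConjugate InnerProductSpace
open MeasureTheory Filter Set Metric
open Literature.MathematicalPhysics.QuantumLattice Literature.MathematicalPhysics.AQFT
open Literature.MathematicalPhysics.QuantumFieldTheory
open Literature.MathematicalPhysics.QuantumLattice.SchwingerFamily (timeVec)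

namespace Summit.QuantumFields.YangMills.Theorems.CurvatureKernel

section Identification

variable (ϖ : (EuclideanSpace ℝ (Fin 4)) → ℝ) (hϖc : Continuous ϖ) (hϖ0 : ∀ x, 0 ≤ ϖ x) (hϖ1 : ∀ x, ϖ x ≤ 1)
  (hϖsupp : tsupport ϖ ⊆ Metric.closedBall (0 : (EuclideanSpace ℝ (Fin 4))) 2)
  (hϖle : ∀ (N : ℕ) (y : (EuclideanSpace ℝ (Fin 4))), ∑ j ∈ Fintype.piFinset (fun _ : Fin 4 => Finset.Icc (-(N : ℤ)) N),
    ϖ (y - WithLp.toLp 2 (fun i => ((j i : ℤ) : ℝ))) ≤ 1)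
  (hϖeq : ∀ (N : ℕ) (y : (EuclideanSpace ℝ (Fin 4))), (∀ i : Fin 4, |y i| ≤ N) →
    ∑ j ∈ Fintype.piFinset (fun _ : Fin 4 => Finset.Icc (-(N : ℤ)) N), ϖ (y - WithLp.toLp 2 (fun i => ((j i : ℤ) : ℝ))) = 1)
  (hI : 0 < ∫ x, ϖ x)
  (b : ℕ → (EuclideanSpace ℝ (Fin 4)) → 𝓢(EuclideanSpace ℝ (Fin 4), ℝ))
  (hb : ∀ (n : ℕ) (c x : EuclideanSpace ℝ (Fin 4)), b n c x = ϖ ((((n : ℝ) + 2)) • (x - c)))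
  {S : SchwingerFamily (EuclideanSpace ℝ (Fin 4))} (h : OSReconstructionNoE1 S.toLabelled)
  (htr : (∀ (n : ℕ) (a : (EuclideanSpace ℝ (Fin 4))) (F : SchwartzMap (Fin n → (EuclideanSpace ℝ (Fin 4))) ℂ), IsOffDiagonal F → S n (translateMulti a F) = S n F))
  (𝒰 : Ultrafilter ℕ) (h𝒰 : (↑𝒰 : Filter ℕ) ≤ atTop)

include hϖc hϖ0 hϖsupp hϖle hϖeq hI in
/-- **Riemann sums of weakly convergent, equicontinuous matrix elements** (stub H): for `Φc` continuous into a
Hilbert space, `wₙ` bounded with weak `𝒰`-limit `Ψ`, and a real test function `u` supported in `B̄(q,R)`, the sums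
`Σ_j u(Δₙ j) Δₙ⁴∫ϖ ⟪Φc(Δₙ j), wₙ⟫` over the cubes `[-Nₙ,Nₙ]⁴` (`Nₙ Δₙ ≥ ‖q‖ + R + 1`) tend to `∫ u ⟪Φc, Ψ⟫` along
`𝒰` (equicontinuity on a compact neighbourhood, uniform convergence along `𝒰`, Riemann sums through the exact
partition of unity). [folklore] -/
theorem tendsto_riemannSum_inner {H : Type*} [NormedAddCommGroup H] [InnerProductSpace ℂ H]
    (𝒰 : Ultrafilter ℕ) (h𝒰 : (↑𝒰 : Filter ℕ) ≤ atTop)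
    (Φc : EuclideanSpace ℝ (Fin 4) → H) (hΦc_cont : Continuous Φc)
    (w : ℕ → H) (Cw : ℝ) (hCw : ∀ n, ‖w n‖ ≤ Cw)
    (Ψ : H) (hΨ : ∀ Φ : H, Tendsto (fun n => ⟪Φ, w n⟫_ℂ) (↑𝒰 : Filter ℕ) (𝓝 ⟪Φ, Ψ⟫_ℂ))
    (u : 𝓢(EuclideanSpace ℝ (Fin 4), ℝ)) (q : EuclideanSpace ℝ (Fin 4)) (R : ℝ) (hR : 0 < R)
    (hu : tsupport (u : EuclideanSpace ℝ (Fin 4) → ℝ) ⊆ Metric.closedBall q R)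
    (N : ℕ → ℕ) (hNΔ : ∀ n : ℕ, ‖q‖ + R + 1 ≤ (N n : ℝ) * ((n : ℝ) + 2)⁻¹) :
    Tendsto (fun n => ∑ j ∈ Fintype.piFinset (fun _ : Fin 4 => Finset.Icc (-(N n : ℤ)) (N n)),
        (u (((n : ℝ) + 2)⁻¹ • WithLp.toLp 2 (fun i => ((j i : ℤ) : ℝ))) : ℂ) *
          ((((n : ℝ) + 2)⁻¹ ^ 4 * ∫ x, ϖ x : ℝ) : ℂ) *
          ⟪Φc (((n : ℝ) + 2)⁻¹ • WithLp.toLp 2 (fun i => ((j i : ℤ) : ℝ))), w n⟫_ℂ)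
      (↑𝒰 : Filter ℕ) (𝓝 (∫ c, (u c : ℂ) * ⟪Φc c, Ψ⟫_ℂ)) := by
  -- ### notation
  set I : ℝ := ∫ x, ϖ x with hIdef
  set Gn : ℕ → EuclideanSpace ℝ (Fin 4) → ℂ := fun n c => ⟪Φc c, w n⟫_ℂ with hGn
  set G' : EuclideanSpace ℝ (Fin 4) → ℂ := fun c => ⟪Φc c, Ψ⟫_ℂ with hG'
  have hG'_cont : Continuous G' := hΦc_cont.inner continuous_const
  have hΔpos : ∀ n : ℕ, (0 : ℝ) < ((n : ℝ) + 2)⁻¹ := fun n => by positivity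
  have hΔ : Tendsto (fun n : ℕ => ((n : ℝ) + 2)⁻¹) atTop (𝓝 0) :=
    tendsto_inv_atTop_zero.comp (tendsto_natCast_atTop_atTop.atTop_add tendsto_const_nhds)
  set gpt : ℕ → (Fin 4 → ℤ) → EuclideanSpace ℝ (Fin 4) := fun n j => ((n : ℝ) + 2)⁻¹ • WithLp.toLp 2 (fun i => ((j i : ℤ) : ℝ)) with hgpt
  set J : ℕ → Finset (Fin 4 → ℤ) := fun n => Fintype.piFinset (fun _ : Fin 4 => Finset.Icc (-(N n : ℤ)) (N n)) with hJ
  set Ssum : ℕ → ℂ := fun n => ∑ j ∈ J n, (u (gpt n j) : ℂ) * ((((n : ℝ) + 2)⁻¹ ^ 4 * I : ℝ) : ℂ) * Gn n (gpt n j)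
    with hSsum
  show Tendsto Ssum (↑𝒰 : Filter ℕ) (𝓝 (∫ c, (u c : ℂ) * G' c))
  -- the exactness region contains `B̄(q, R + 2Δ)` once `4Δ ≤ 1`
  have hregion : ∀ n : ℕ, 4 * ((n : ℝ) + 2)⁻¹ ≤ 1 → ∀ x ∈ Metric.closedBall q (R + 2 * ((n : ℝ) + 2)⁻¹),
      ∀ i : Fin 4, |x i| + 2 * ((n : ℝ) + 2)⁻¹ ≤ N n * ((n : ℝ) + 2)⁻¹ := by
    intro n hn x hx i
    rw [Metric.mem_closedBall, dist_eq_norm] at hx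
    have h1 : |x i| ≤ ‖x‖ := by simpa using PiLp.norm_apply_le (p := 2) x i
    have h2 : ‖x‖ ≤ ‖q‖ + (R + 2 * ((n : ℝ) + 2)⁻¹) := by
      have := norm_le_norm_add_norm_sub' x q
      rw [norm_sub_rev] at hx
      linarith [norm_sub_rev q x]
    linarith [hNΔ n]
  have hgpt_mem : ∀ n j, u (gpt n j) ≠ 0 → gpt n j ∈ Metric.closedBall q R := fun n j hj =>
    hu (subset_tsupport _ (Function.mem_support.2 hj))
  -- compactness data
  set Kc : Set (EuclideanSpace ℝ (Fin 4)) := Metric.closedBall q (R + 1) with hKc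
  have hKc_cpt : IsCompact Kc := isCompact_closedBall _ _
  have hballK : ∀ n : ℕ, 4 * ((n : ℝ) + 2)⁻¹ ≤ 1 → Metric.closedBall q (R + 2 * ((n : ℝ) + 2)⁻¹) ⊆ Kc :=
    fun n hn => Metric.closedBall_subset_closedBall (by linarith)
  set VK : ℝ := (volume Kc).toReal with hVK
  have hVK0 : 0 ≤ VK := ENNReal.toReal_nonneg
  have hvol_le : ∀ n : ℕ, 4 * ((n : ℝ) + 2)⁻¹ ≤ 1 →
      (volume (Metric.closedBall q (R + 2 * ((n : ℝ) + 2)⁻¹))).toReal ≤ VK := fun n hn =>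
    ENNReal.toReal_mono measure_closedBall_lt_top.ne (measure_mono (hballK n hn))
  -- `u` and `u G'` are uniformly continuous (compact support)
  have hu_cpt : HasCompactSupport (u : EuclideanSpace ℝ (Fin 4) → ℝ) :=
    HasCompactSupport.of_support_subset_isCompact (isCompact_closedBall q R)
      ((subset_tsupport _).trans hu)
  have hu_uc : UniformContinuous (u : EuclideanSpace ℝ (Fin 4) → ℝ) := hu_cpt.uniformContinuous_of_continuous u.continuous
  set uG : EuclideanSpace ℝ (Fin 4) → ℂ := fun c => (u c : ℂ) * G' c with huG
  have huG_cont : Continuous uG := (Complex.continuous_ofReal.comp u.continuous).mul hG'_cont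
  have huG_supp : Function.support uG ⊆ Metric.closedBall q R := by
    intro c hc
    refine hu (subset_tsupport _ ?_)
    rw [Function.mem_support] at hc ⊢
    intro h0; exact hc (by simp [huG, h0])
  have huG_cpt : HasCompactSupport uG :=
    HasCompactSupport.of_support_subset_isCompact (isCompact_closedBall q R) huG_supp
  have huG_uc : UniformContinuous uG := huG_cpt.uniformContinuous_of_continuous huG_cont
  set uA : EuclideanSpace ℝ (Fin 4) → ℂ := fun c => ((|u c| : ℝ) : ℂ) with huA
  have huA_cont : Continuous uA := Complex.continuous_ofReal.comp (continuous_abs.comp u.continuous)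
  have huA_supp : Function.support uA ⊆ Metric.closedBall q R := by
    intro c hc
    refine hu (subset_tsupport _ ?_)
    rw [Function.mem_support] at hc ⊢
    intro h0; exact hc (by simp [huA, h0])
  have huA_cpt : HasCompactSupport uA :=
    HasCompactSupport.of_support_subset_isCompact (isCompact_closedBall q R) huA_supp
  have huA_uc : UniformContinuous uA := huA_cpt.uniformContinuous_of_continuous huA_cont
  -- the integral of `|u|`
  set Iu : ℝ := ∫ c, |u c| with hIu
  have hIu0 : 0 ≤ Iu := integral_nonneg fun _ => abs_nonneg _
  -- equicontinuity of `Gn` on `Kc` and pointwise convergence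
  have hGn_pt : ∀ x ∈ Kc, Tendsto (fun n => Gn n x) (↑𝒰 : Filter ℕ) (𝓝 (G' x)) := fun x _ => hΨ (Φc x)
  have hCw0 : 0 ≤ Cw := (norm_nonneg _).trans (hCw 0)
  have hGn_eq : ∀ ε > (0 : ℝ), ∃ δ > (0 : ℝ), ∀ n, ∀ x ∈ Kc, ∀ y ∈ Kc, dist x y < δ → dist (Gn n x) (Gn n y) ≤ ε := by
    intro ε hε
    have hΦuc : UniformContinuousOn Φc Kc := hKc_cpt.uniformContinuousOn_of_continuous hΦc_cont.continuousOn
    rw [Metric.uniformContinuousOn_iff] at hΦuc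
    obtain ⟨δ, hδ, hδΦ⟩ := hΦuc (ε / (Cw + 1)) (by positivity)
    refine ⟨δ, hδ, fun n x hx y hy hxy => ?_⟩
    have h1 : dist (Φc x) (Φc y) < ε / (Cw + 1) := hδΦ x hx y hy hxy
    rw [dist_eq_norm] at h1 ⊢
    calc ‖Gn n x - Gn n y‖ = ‖⟪Φc x - Φc y, w n⟫_ℂ‖ := by rw [hGn]; simp only [inner_sub_left]
      _ ≤ ‖Φc x - Φc y‖ * ‖w n‖ := norm_inner_le_norm _ _
      _ ≤ ε / (Cw + 1) * Cw := mul_le_mul h1.le (hCw n) (norm_nonneg _) (by positivity)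
      _ ≤ ε := by rw [div_mul_eq_mul_div, div_le_iff₀ (by positivity)]; nlinarith
  have hGunif := tendstoUniformlyOn_of_equicontinuous hKc_cpt Gn G' hGn_pt hGn_eq
  -- ### the `ε`-argument
  rw [Metric.tendsto_nhds]
  intro ε' hε'
  set ε : ℝ := min 1 (ε' / (2 * (Iu + 2 * VK + 2))) with hεdef
  have hε : 0 < ε := lt_min one_pos (by positivity)
  have hε1 : ε ≤ 1 := min_le_left _ _
  have hε2 : ε * (2 * (Iu + 2 * VK + 2)) ≤ ε' := by
    have := min_le_right 1 (ε' / (2 * (Iu + 2 * VK + 2)))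
    rwa [le_div_iff₀ (by positivity)] at this
  -- moduli at scale `2Δ` for `u G'`, `|u|` (with `ε`) and exactness conditions, eventually `atTop`
  obtain ⟨δ₁, hδ₁, hδ₁G⟩ := Metric.uniformContinuous_iff.1 huG_uc ε hε
  obtain ⟨δ₂, hδ₂, hδ₂A⟩ := Metric.uniformContinuous_iff.1 huA_uc ε hε
  have hev : ∀ᶠ n : ℕ in atTop, 4 * ((n : ℝ) + 2)⁻¹ ≤ 1 ∧ 2 * ((n : ℝ) + 2)⁻¹ < δ₁ ∧ 2 * ((n : ℝ) + 2)⁻¹ < δ₂ := by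
    refine ((hΔ.const_mul 4).eventually (ge_mem_nhds ?_)).and
      (((hΔ.const_mul 2).eventually (gt_mem_nhds ?_)).and ((hΔ.const_mul 2).eventually (gt_mem_nhds ?_)))
    · norm_num
    · simpa using hδ₁
    · simpa using hδ₂
  filter_upwards [hev.filter_mono h𝒰, hGunif ε hε] with n hn hGn
  obtain ⟨hn1, hn2, hn3⟩ := hn
  set Δ : ℝ := ((n : ℝ) + 2)⁻¹ with hΔdef
  have hΔp : 0 < Δ := hΔpos n
  have hreg := hregion n hn1
  -- (i) `S∞ − ∫ uG` by the Riemann lemma applied to `uG`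
  have hmodG : ∀ x y : EuclideanSpace ℝ (Fin 4), dist x y ≤ 2 * Δ → ‖uG x - uG y‖ ≤ ε := fun x y hxy => by
    have := (hδ₁G (lt_of_le_of_lt hxy hn2)).le; rwa [dist_eq_norm] at this
  have h1 := norm_riemannSum_sub_integral_le ϖ hϖc hϖ0 hϖsupp hϖle hϖeq hΔp (N n) uG huG_cont q R hR.le
    huG_supp hreg hε.le hmodG
  -- (ii) `∑ |u(g)| Δ⁴ I ≤ Iu + VK` by the Riemann lemma applied to `|u|` with modulus `ε ≤ 1`? use `ε`
  have hmodA : ∀ x y : EuclideanSpace ℝ (Fin 4), dist x y ≤ 2 * Δ → ‖uA x - uA y‖ ≤ ε := fun x y hxy => by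
    have := (hδ₂A (lt_of_le_of_lt hxy hn3)).le; rwa [dist_eq_norm] at this
  have h2 := norm_riemannSum_sub_integral_le ϖ hϖc hϖ0 hϖsupp hϖle hϖeq hΔp (N n) uA huA_cont q R hR.le
    huA_supp hreg hε.le hmodA
  have hvol := hvol_le n hn1
  -- the real mass of the Riemann sum of `|u|`
  set su : ℝ := ∑ j ∈ J n, |u (gpt n j)| * (Δ ^ 4 * I) with hsu
  have hsu0 : 0 ≤ su := Finset.sum_nonneg fun j _ => by positivity
  have hsuC : (∑ j ∈ J n, uA (Δ • WithLp.toLp 2 (fun i => ((j i : ℤ) : ℝ))) * ((Δ ^ 4 * ∫ y, ϖ y : ℝ) : ℂ)) = ((su : ℝ) : ℂ) := by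
    rw [hsu]; push_cast; rfl
  have hIuC : ∫ x, uA x = ((Iu : ℝ) : ℂ) := by rw [huA, hIu]; exact integral_complex_ofReal
  have hsu_le : su ≤ Iu + ε * VK := by
    rw [hsuC, hIuC, ← Complex.ofReal_sub, Complex.norm_real, Real.norm_eq_abs] at h2
    have := (abs_sub_le_iff.1 h2).1
    nlinarith [mul_le_mul_of_nonneg_left hvol hε.le]
  -- the sum against the limit `G'`
  set Sinf : ℂ := ∑ j ∈ J n, (u (gpt n j) : ℂ) * ((Δ ^ 4 * I : ℝ) : ℂ) * G' (gpt n j) with hSinf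
  have hSinf_eq : (∑ j ∈ J n, uG (Δ • WithLp.toLp 2 (fun i => ((j i : ℤ) : ℝ))) * ((Δ ^ 4 * ∫ y, ϖ y : ℝ) : ℂ)) = Sinf := by
    rw [hSinf]
    refine Finset.sum_congr rfl fun j _ => ?_
    simp only [huG, hgpt]
    ring
  rw [hSinf_eq] at h1
  -- (a) `‖Ssum n − Sinf‖ ≤ ε su`
  have hA' : ‖Ssum n - Sinf‖ ≤ ε * su := by
    have hdiff : Ssum n - Sinf = ∑ j ∈ J n, (u (gpt n j) : ℂ) * ((Δ ^ 4 * I : ℝ) : ℂ) * (Gn n (gpt n j) - G' (gpt n j)) := by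
      rw [hSsum, hSinf, ← Finset.sum_sub_distrib]
      refine Finset.sum_congr rfl fun j _ => ?_
      ring
    rw [hdiff, hsu, Finset.mul_sum]
    refine (norm_sum_le _ _).trans (Finset.sum_le_sum fun j _ => ?_)
    rw [norm_mul, norm_mul, Complex.norm_real, Complex.norm_real, Real.norm_eq_abs,
      Real.norm_of_nonneg (by positivity : (0 : ℝ) ≤ Δ ^ 4 * I)]
    by_cases hj : u (gpt n j) = 0
    · simp [hj]
    · have hmem : gpt n j ∈ Kc := (Metric.closedBall_subset_closedBall (by linarith)) (hgpt_mem n j hj)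
      have h3 : ‖Gn n (gpt n j) - G' (gpt n j)‖ ≤ ε := by rw [← dist_eq_norm]; exact hGn _ hmem
      calc |u (gpt n j)| * (Δ ^ 4 * I) * ‖Gn n (gpt n j) - G' (gpt n j)‖
          ≤ |u (gpt n j)| * (Δ ^ 4 * I) * ε := mul_le_mul_of_nonneg_left h3 (by positivity)
        _ = ε * (|u (gpt n j)| * (Δ ^ 4 * I)) := by ring
  -- (b) assembly
  rw [dist_eq_norm]
  calc ‖Ssum n - ∫ c, (u c : ℂ) * G' c‖
      = ‖(Ssum n - Sinf) + (Sinf - ∫ c, uG c)‖ := by rw [huG]; congr 1; ring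
    _ ≤ ‖Ssum n - Sinf‖ + ‖Sinf - ∫ c, uG c‖ := norm_add_le _ _
    _ ≤ ε * su + ε * VK := add_le_add hA' (h1.trans (mul_le_mul_of_nonneg_left hvol hε.le))
    _ ≤ ε * (Iu + ε * VK) + ε * VK := by nlinarith [mul_le_mul_of_nonneg_left hsu_le hε.le]
    _ ≤ ε * (Iu + 2 * VK + 2) := by nlinarith [mul_le_mul_of_nonneg_left hε1 (mul_nonneg hε.le hVK0)]
    _ < ε' := by nlinarith

end Identification

/-- **Sub-goal `CubeExactnessRegion`** (helper-file headline for stub `HalfSpaceKernel`; registered signature): the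
cubes `[-Nₙ,Nₙ]⁴` at scale `Δₙ = (n+2)⁻¹` with `Nₙ Δₙ ≥ ‖q‖ + R + 1` contain, with margin `2Δₙ`, the closed ball
`B̄(q, R + 2Δₙ)` as soon as `4Δₙ ≤ 1`. [folklore] -/
theorem CubeExactnessRegion : ∀ (q : EuclideanSpace ℝ (Fin 4)) (R : ℝ) (N : ℕ → ℕ), (∀ n : ℕ, ‖q‖ + R + 1 ≤ (N n : ℝ) * ((n : ℝ) + 2)⁻¹) → ∀ n : ℕ, 4 * ((n : ℝ) + 2)⁻¹ ≤ 1 → ∀ x ∈ Metric.closedBall q (R + 2 * ((n : ℝ) + 2)⁻¹), ∀ i : Fin 4, |x i| + 2 * ((n : ℝ) + 2)⁻¹ ≤ N n * ((n : ℝ) + 2)⁻¹ := by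
  intro q R N hNΔ n hn x hx i
  rw [Metric.mem_closedBall, dist_eq_norm] at hx
  have h1 : |x i| ≤ ‖x‖ := by simpa using PiLp.norm_apply_le (p := 2) x i
  have h2 : ‖x‖ ≤ ‖q‖ + (R + 2 * ((n : ℝ) + 2)⁻¹) := by
    have := norm_le_norm_add_norm_sub' x q
    rw [norm_sub_rev] at hx
    linarith [norm_sub_rev q x]
  linarith [hNΔ n]

end Summit.QuantumFields.YangMills.Theorems.CurvatureKernel

end
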